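import Literature.Computability.QuantumComplexity.PermanentSearchRandom
import Literature.Computability.Complexity.FoldBricks
import Literature.Computability.Complexity.NatSqrtFP
import Literature.Computability.Complexity.ZIntBricks
import HarnessLib

/-!
# The arithmetic of the AA13 permanent search as `FP` bricks: factorials, half-widths, clocks, keys, coin blocks

Aaronson–Arkhipov, *The computational complexity of linear optics*, Theory of Computing 9 (2013),
proof of Thm. 4.3 (pp. 176–177). The search `PerSearch.perLevel` (`PermanentSearch.lean`) and its
randomised wrapper `PerSearch.randComp` (`PermanentSearchRandom.lean`) are specified with a handful
of arithmetic functions — the clamped half-width numerator `halfK g n v D = min (⌊√(g v)⌋ + 1, g (n+1)! D + 1)`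
(eq. (4.9)), the round count `rounds g n = ⌊log₂ (4 g² ((n+1)!)²)⌋ + 1` (eqs. (4.16)–(4.18)), the
comparison of grid points by the normalised value `keyW (r, v) = v / den(r)²` (eq. (4.15): "the
`s(i)` for which `O(X^{[s(i)]})` is minimized"), and the coin map of the wrapper (the block index
`i · NS + siteIdx s` and the block `chunk ℓ j r` of the `BPP` machine's coins spliced into the query
`perSqQuery`, Thm. 1.1, p. 149). This file realises them as total string functions in the brick
algebra (`BrickAlgebra.lean`, `FoldBricks.lean`), each in `FP` with its value on numerals:

* `factUF 1ⁿ = bin n!` (a product fold, `Brick.foldAcc_prodFn`);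
* `halfKF G ⟨v, ⟨D, F⟩⟩ = bin (min (⌊√(G ⟦v⟧)⌋ + 1) (G ⟦F⟧ ⟦D⟧ + 1))` (`= halfK G n ⟦v⟧ ⟦D⟧` for `⟦F⟧ = (n+1)!`;
  the binary integer square root is `Brick.natSqrt_mem_FP` of `NatSqrtFP.lean`);
* `roundsF G F = bin (⌊log₂ (4 G² ⟦F⟧²)⌋ + 1)` (`= rounds G n` for `⟦F⟧ = (n+1)!`; the logarithm is the
  length of the binary numeral, `size_eq_log_succ`);
* `keyLtF ⟨⟨v₁, D₁⟩, ⟨v₂, D₂⟩⟩ = [v₁ D₂² < v₂ D₁²]`, which is `[keyW (r₁, v₁) < keyW (r₂, v₂)]` for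
  `Dᵢ = den rᵢ` (`keyW_lt_iff`);
* the grid points `gridPt r β' (3g) i`, `β' = K/(D P_Y)`, as ONE fraction: `gridPt_eq_div` (numerator
  `gridZ = a P_Y L − K L + 2 K i`, `L = 3g`, over `gridM = D P_Y L`; for `g = 0` Lean's `2β'/0 = 0` gives
  `(a P_Y − K)/(D P_Y)`), and the bricks `gridZF G` (a difference pair) and `gridMF G` (a numeral), to
  be reduced to lowest terms by `Brick.qnormF` (`RatBricks.lean`);
* `blockIdxF G q₀` (the block index from `|x|`, the sub-run `i` and the site), `chunkF G c q₀` (the coin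
  block) and `querF G c q₀` (the relabelled query `coinMap G c q₀ x r i (canon s M)` from the matrix
  code, `querF_apply`), the polynomials `kp`, `ellp`, `NSp`, `Rp` of `PermanentSearchRandom.lean` being
  evaluated in unary by `Plumb.polyFn`.

## References

* S. Aaronson, A. Arkhipov, *The computational complexity of linear optics*, Theory of Computing 9
  (2013), proof of Thm. 4.3, eqs. (4.9), (4.15)–(4.18) (p. 177); Thm. 1.1 (p. 149).
* S. Arora, B. Barak, *Computational Complexity: A Modern Approach*, CUP 2009, §1.3 (closure of
  polynomial time under composition and bounded loops), §7.4.1 (fresh coins per call).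
-/

noncomputable section

namespace Literature.Computability.QuantumComplexity

open _root_.Computability Complexity Complexity.Brick Complexity.Plumb Polynomial

namespace PerSearch

/-! ### Factorials -/

/-- The initial record `⟨x, ⟨bin |x|, ⟨1⁰, bin 1⟩⟩⟩` of the factorial fold. [folklore] -/
def factSetup : List Bool → List Bool := fanoutFn id (fanoutFn lenBinF fun _ => boolPair [] [true])

/-- Value of the initial record. [folklore] -/
theorem factSetup_apply (x : List Bool) :
    factSetup x = boolPair x (boolPair (encodeNat x.length) (boolPair (ones 0) (encodeNat 1))) := by
  simp [factSetup, ones, (by decide : encodeNat 1 = [true])]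

/-- `factSetup ∈ FP`. [cite: AroraBarak2009, §1.3] -/
theorem factSetup_mem_FP : factSetup ∈ FP :=
  fanoutFn_mem_FP OracleCompose.id_mem_FP (fanoutFn_mem_FP lenBinF_mem_FP (const_mem_FP _))

/-- The piece `⟨x, 1ⁱ⟩ ↦ bin (i + 1)` of the factorial fold. [folklore] -/
def factPiece : List Bool → List Bool := lenBinF ∘ List.cons true ∘ sndF

/-- Value of the piece. [folklore] -/
theorem factPiece_apply (x : List Bool) (i : ℕ) : factPiece (boolPair x (ones i)) = encodeNat (i + 1) := by
  simp [factPiece, ones]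

/-- `factPiece ∈ FP`. [cite: AroraBarak2009, §1.3] -/
theorem factPiece_mem_FP : factPiece ∈ FP :=
  comp_mem_FP lenBinF_mem_FP (comp_mem_FP (cons_mem_FP true) sndF_mem_FP)

/-- **The factorial of a unary numeral in binary**: `factUF 1ⁿ = bin n!`, by the product fold of the
pieces `bin 1, …, bin n` (clipped: piece `i < n` has `≤ n` symbols). (The factorial brick
`BosonFP.factF` of `BosonReductionMachine.lean` reads the dimension off a MATRIX CODE `qcode M`; this
one reads a unary numeral, the form in which the machine of the search holds dimensions.) [cite: AroraBarak2009, §1.3 (bounded loops)] -/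
def factUF : List Bool → List Bool := sndPow 2 ∘ foldLoop prodFn (clipF 1 factPiece) X ∘ factSetup

/-- `factUF ∈ FP`. [cite: AroraBarak2009, §1.3] -/
theorem factF_mem_FP : factUF ∈ FP :=
  comp_mem_FP (sndPow_mem_FP 2) (comp_mem_FP (foldLoop_clipF_mem_FP 1 prodFn_mem_FP length_prodFn_le factPiece_mem_FP _)
    factSetup_mem_FP)

/-- **`factUF 1ⁿ = bin n!`** (indeed `factUF x = bin |x|!` on every `x`). [folklore] -/
theorem factF_apply (x : List Bool) : factUF x = encodeNat x.length.factorial := by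
  have hle : x.length ≤ (X : Polynomial ℕ).eval x.length := by simp
  rw [factUF, Function.comp_apply, Function.comp_apply, factSetup_apply, foldLoop_apply _ _ hle, sndPow_succ_boolPair,
    sndPow_succ_boolPair, sndPow_zero_boolPair,
    foldAcc_clipF (fun j _ hj => by
      rw [factPiece_apply]
      have h1 : (encodeNat (j + 1)).length ≤ j + 1 := by
        rw [TM2Pass.length_encodeNat_eq_size]; exact Nat.size_le.2 Nat.lt_two_pow_self
      omega),
    foldAcc_prodFn]
  congr 1
  rw [one_mul]
  refine (Finset.prod_congr rfl fun j _ => ?_).trans (Finset.prod_range_add_one_eq_factorial x.length)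
  rw [Nat.zero_add, factPiece_apply, bitsToNat_encodeNat]

/-! ### The clamped half-width numerator `halfK` -/

/-- The binary integer square root as a named string function (`NatSqrtFP.lean`). [folklore] -/
def sqrtBF : List Bool → List Bool := fun w => encodeNat (Nat.sqrt (bitsToNat w))

/-- `sqrtBF ∈ FP` (`Brick.natSqrt_mem_FP`). [cite: AroraBarak2009, §1.3] -/
theorem sqrtBF_mem_FP : sqrtBF ∈ FP := natSqrt_mem_FP

/-- On `⟨v, ⟨D, F⟩⟩`: `bin (⌊√(G ⟦v⟧)⌋ + 1)`. [cite: AaronsonArkhipovToC2013, proof of Thm. 4.3, eq. (4.9) (p. 177)] -/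
def hkS (G : ℕ) : List Bool → List Bool :=
  addFn ∘ fanoutFn (sqrtBF ∘ prodFn ∘ fanoutFn (fun _ => encodeNat G) fstF) (fun _ => [true])

/-- Value of `hkS`. [folklore] -/
theorem hkS_apply (G : ℕ) (v q : List Bool) : hkS G (boolPair v q) = encodeNat (Nat.sqrt (G * bitsToNat v) + 1) := by
  simp [hkS, sqrtBF]

/-- `hkS G ∈ FP`. [cite: AroraBarak2009, §1.3] -/
theorem hkS_mem_FP (G : ℕ) : hkS G ∈ FP :=
  comp_mem_FP addFn_mem_FP (fanoutFn_mem_FP (comp_mem_FP sqrtBF_mem_FP (comp_mem_FP prodFn_mem_FP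
    (fanoutFn_mem_FP (const_mem_FP _) fstF_mem_FP))) (const_mem_FP _))

/-- On `⟨v, ⟨D, F⟩⟩`: the clamp `bin (G ⟦F⟧ ⟦D⟧ + 1)`. [cite: AaronsonArkhipovToC2013, proof of Thm. 4.3, eq. (4.9) (p. 177)] -/
def hkB (G : ℕ) : List Bool → List Bool :=
  addFn ∘ fanoutFn (prodFn ∘ fanoutFn (prodFn ∘ fanoutFn (fun _ => encodeNat G) (sndF ∘ sndF)) (fstF ∘ sndF)) (fun _ => [true])

/-- Value of `hkB`. [folklore] -/
theorem hkB_apply (G : ℕ) (v D F : List Bool) :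
    hkB G (boolPair v (boolPair D F)) = encodeNat (G * bitsToNat F * bitsToNat D + 1) := by
  simp [hkB]

/-- `hkB G ∈ FP`. [cite: AroraBarak2009, §1.3] -/
theorem hkB_mem_FP (G : ℕ) : hkB G ∈ FP :=
  comp_mem_FP addFn_mem_FP (fanoutFn_mem_FP (comp_mem_FP prodFn_mem_FP (fanoutFn_mem_FP
    (comp_mem_FP prodFn_mem_FP (fanoutFn_mem_FP (const_mem_FP _) (comp_mem_FP sndF_mem_FP sndF_mem_FP)))
    (comp_mem_FP fstF_mem_FP sndF_mem_FP))) (const_mem_FP _))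

/-- **The clamped half-width numerator** on `⟨v, ⟨D, F⟩⟩`: the smaller of `hkS` and `hkB`. [cite: AaronsonArkhipovToC2013, proof of Thm. 4.3, eq. (4.9) (p. 177)] -/
def halfKF (G : ℕ) : List Bool → List Bool := iteFn (ltFn ∘ fanoutFn (hkS G) (hkB G)) (hkS G) (hkB G)

/-- `halfKF G ∈ FP`. [cite: AroraBarak2009, §1.3] -/
theorem halfKF_mem_FP (G : ℕ) : halfKF G ∈ FP :=
  iteFn_mem_FP (comp_mem_FP ltFn_mem_FP (fanoutFn_mem_FP (hkS_mem_FP G) (hkB_mem_FP G))) (hkS_mem_FP G) (hkB_mem_FP G)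

/-- **Value of `halfKF`**: `bin (min (⌊√(G v)⌋ + 1) (G F D + 1))`. [folklore] -/
theorem halfKF_apply (G : ℕ) (v D F : List Bool) :
    halfKF G (boolPair v (boolPair D F)) =
      encodeNat (min (Nat.sqrt (G * bitsToNat v) + 1) (G * bitsToNat F * bitsToNat D + 1)) := by
  have hc : (ltFn ∘ fanoutFn (hkS G) (hkB G)) (boolPair v (boolPair D F)) =
      [decide (Nat.sqrt (G * bitsToNat v) + 1 < G * bitsToNat F * bitsToNat D + 1)] := by
    simp [hkS_apply, hkB_apply]
  rw [halfKF, iteFn_apply hc]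
  by_cases h : Nat.sqrt (G * bitsToNat v) + 1 < G * bitsToNat F * bitsToNat D + 1
  · rw [decide_eq_true h, min_eq_left h.le]; exact hkS_apply G v _
  · rw [decide_eq_false h, min_eq_right (not_lt.1 h)]; exact hkB_apply G v D F

/-- `halfKF` computes `halfK` when the third field holds `(n+1)!`. [cite: AaronsonArkhipovToC2013, proof of Thm. 4.3, eq. (4.9) (p. 177)] -/
theorem halfKF_eq_halfK (G n v D : ℕ) :
    halfKF G (boolPair (encodeNat v) (boolPair (encodeNat D) (encodeNat (n + 1).factorial))) = encodeNat (halfK G n v D) := by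
  rw [halfKF_apply, bitsToNat_encodeNat, bitsToNat_encodeNat, bitsToNat_encodeNat, halfK]

/-- `halfKF` outputs are short: at most `|hkB|`, i.e. polynomial in the operands. [folklore] -/
theorem length_halfKF_le (G : ℕ) (v D F : List Bool) :
    (halfKF G (boolPair v (boolPair D F))).length ≤ (encodeNat (G * bitsToNat F * bitsToNat D + 1)).length := by
  rw [halfKF_apply]
  exact length_encodeNat_mono (min_le_right _ _)

/-! ### The round count -/

/-- The binary size of a positive number is its logarithm plus one. (Twin of
`Literature.Computability.Cryptography.LPO.size_eq_log_succ` of `Cryptography/LiuPassOWFProgram.lean`,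
a machine file of the Liu–Pass development that is not importable here; librarian: hoist both next to
`TM2Pass.length_encodeNat_eq_size`.) [folklore] -/
theorem size_eq_log_succ {x : ℕ} (hx : x ≠ 0) : Nat.size x = Nat.log 2 x + 1 := by
  refine le_antisymm (Nat.size_le.2 (Nat.lt_pow_succ_log_self one_lt_two x)) ?_
  exact Nat.lt_size.2 (Nat.pow_log_le_self 2 hx)

/-- On `F`: the argument `bin (4 G² ⟦F⟧²)` of the logarithm. [cite: AaronsonArkhipovToC2013, proof of Thm. 4.3, eqs. (4.16)–(4.18) (p. 177)] -/
def roundsArgF (G : ℕ) : List Bool → List Bool := prodFn ∘ fanoutFn (fun _ => encodeNat (4 * G ^ 2)) (prodFn ∘ fanoutFn id id)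

/-- Value of `roundsArgF`. [folklore] -/
theorem roundsArgF_apply (G : ℕ) (F : List Bool) : roundsArgF G F = encodeNat (4 * G ^ 2 * bitsToNat F ^ 2) := by
  simp [roundsArgF, sq, mul_assoc]

/-- `roundsArgF G ∈ FP`. [cite: AroraBarak2009, §1.3] -/
theorem roundsArgF_mem_FP (G : ℕ) : roundsArgF G ∈ FP :=
  comp_mem_FP prodFn_mem_FP (fanoutFn_mem_FP (const_mem_FP _) (comp_mem_FP prodFn_mem_FP
    (fanoutFn_mem_FP OracleCompose.id_mem_FP OracleCompose.id_mem_FP)))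

/-- **The round count** on `F`: `bin (⌊log₂ (4 G² ⟦F⟧²)⌋ + 1)` — `bin 1` if the argument vanishes, else
the length of its numeral. [cite: AaronsonArkhipovToC2013, proof of Thm. 4.3, eqs. (4.16)–(4.18) (p. 177)] -/
def roundsF (G : ℕ) : List Bool → List Bool := iteFn (isNilFn ∘ roundsArgF G) (fun _ => [true]) (lenBinF ∘ roundsArgF G)

/-- `roundsF G ∈ FP`. [cite: AroraBarak2009, §1.3] -/
theorem roundsF_mem_FP (G : ℕ) : roundsF G ∈ FP :=
  iteFn_mem_FP (comp_mem_FP isNilFn_mem_FP (roundsArgF_mem_FP G)) (const_mem_FP _) (comp_mem_FP lenBinF_mem_FP (roundsArgF_mem_FP G))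

/-- **Value of `roundsF`.** [folklore] -/
theorem roundsF_apply (G : ℕ) (F : List Bool) : roundsF G F = encodeNat (Nat.log 2 (4 * G ^ 2 * bitsToNat F ^ 2) + 1) := by
  set x := 4 * G ^ 2 * bitsToNat F ^ 2 with hx
  have harg := roundsArgF_apply G F
  rw [← hx] at harg
  by_cases h0 : x = 0
  · rw [roundsF, iteFn_apply (b := true) (by simp [isNilFn, harg, h0, (by decide : encodeNat 0 = [])]), if_pos rfl, h0,
      Nat.log_zero_right]
    decide
  · have hne : encodeNat x ≠ [] := fun h => h0 (by rw [← bitsToNat_encodeNat x, h]; rfl)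
    rw [roundsF, iteFn_apply (b := false) (by simp [isNilFn, harg, hne]), if_neg Bool.false_ne_true, Function.comp_apply, harg,
      lenBinF_apply, TM2Pass.length_encodeNat_eq_size, size_eq_log_succ h0]

/-- `roundsF` computes `rounds` when its argument holds `(n+1)!`. [cite: AaronsonArkhipovToC2013, proof of Thm. 4.3, eqs. (4.16)–(4.18) (p. 177)] -/
theorem roundsF_eq_rounds (G n : ℕ) : roundsF G (encodeNat (n + 1).factorial) = encodeNat (rounds G n) := by
  rw [roundsF_apply, bitsToNat_encodeNat, rounds]

/-! ### Comparing grid points by the normalised value -/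

/-- On `⟨⟨v₁, D₁⟩, ⟨v₂, D₂⟩⟩`: **the comparison bit `[v₁ D₂² < v₂ D₁²]`** of two candidates by the
key `v/D²` (cross-multiplied). [cite: AaronsonArkhipovToC2013, proof of Thm. 4.3, eq. (4.15) (p. 177)] -/
def keyLtF : List Bool → List Bool :=
  ltFn ∘ fanoutFn (prodFn ∘ fanoutFn (fstF ∘ fstF) (prodFn ∘ fanoutFn (sndF ∘ sndF) (sndF ∘ sndF)))
    (prodFn ∘ fanoutFn (fstF ∘ sndF) (prodFn ∘ fanoutFn (sndF ∘ fstF) (sndF ∘ fstF)))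

/-- Value of the comparison brick. [folklore] -/
theorem keyLtF_apply (v₁ D₁ v₂ D₂ : List Bool) :
    keyLtF (boolPair (boolPair v₁ D₁) (boolPair v₂ D₂)) =
      [decide (bitsToNat v₁ * bitsToNat D₂ ^ 2 < bitsToNat v₂ * bitsToNat D₁ ^ 2)] := by
  simp [keyLtF, sq]

/-- `keyLtF ∈ FP`. [cite: AroraBarak2009, §1.3] -/
theorem keyLtF_mem_FP : keyLtF ∈ FP :=
  comp_mem_FP ltFn_mem_FP (fanoutFn_mem_FP
    (comp_mem_FP prodFn_mem_FP (fanoutFn_mem_FP (comp_mem_FP fstF_mem_FP fstF_mem_FP)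
      (comp_mem_FP prodFn_mem_FP (fanoutFn_mem_FP (comp_mem_FP sndF_mem_FP sndF_mem_FP) (comp_mem_FP sndF_mem_FP sndF_mem_FP)))))
    (comp_mem_FP prodFn_mem_FP (fanoutFn_mem_FP (comp_mem_FP fstF_mem_FP sndF_mem_FP)
      (comp_mem_FP prodFn_mem_FP (fanoutFn_mem_FP (comp_mem_FP sndF_mem_FP fstF_mem_FP) (comp_mem_FP sndF_mem_FP fstF_mem_FP))))))

/-- `keyLtF` is one-bit. [folklore] -/
theorem oneBit_keyLtF : OneBit keyLtF := fun z => ⟨_, by rw [keyLtF, Function.comp_apply, fanoutFn_apply, ltFn_boolPair]⟩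

/-- **The key comparison, cross-multiplied**: `keyW (r₁, v₁) < keyW (r₂, v₂) ↔ v₁ den(r₂)² < v₂ den(r₁)²`. [cite: AaronsonArkhipovToC2013, proof of Thm. 4.3, eq. (4.15) (p. 177)] -/
theorem keyW_lt_iff (p q : ℚ × ℕ) : keyW p < keyW q ↔ p.2 * q.1.den ^ 2 < q.2 * p.1.den ^ 2 := by
  rw [keyW, keyW, div_lt_div_iff₀ (by positivity) (by positivity)]
  exact_mod_cast Iff.rfl

/-- The comparison brick decides the key comparison on the codes `⟨bin v, bin den⟩` of two candidates. [folklore] -/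
theorem keyLtF_eq_keyW (p q : ℚ × ℕ) :
    keyLtF (boolPair (boolPair (encodeNat p.2) (encodeNat p.1.den)) (boolPair (encodeNat q.2) (encodeNat q.1.den))) =
      [decide (keyW p < keyW q)] := by
  rw [keyLtF_apply]
  simp only [bitsToNat_encodeNat]
  congr 1
  exact (Bool.decide_congr (keyW_lt_iff p q)).symm

/-! ### The grid points as single fractions -/

/-- **Numerator of the `i`-th grid point** `r − β' + i · 2β'/L` with `r = a/D`, `β' = K/(D P_Y)`, `L = 3g`,
over the common denominator `D P_Y L`: `a P_Y L − K L + 2 K i`; for `g = 0` (where Lean reads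
`2β'/0 = 0`) over `D P_Y`: `a P_Y − K`. [cite: AaronsonArkhipovToC2013, proof of Thm. 4.3 (p. 177: "divide `I` into `L` equal segments")] -/
def gridZ (g : ℕ) (a : ℤ) (PY K i : ℕ) : ℤ :=
  if g = 0 then a * PY - K else a * PY * (3 * g) - K * (3 * g) + 2 * K * i

/-- **Denominator of the grid points**: `D P_Y L`, or `D P_Y` for `g = 0`. [cite: AaronsonArkhipovToC2013, proof of Thm. 4.3 (p. 177)] -/
def gridM (g D PY : ℕ) : ℕ := if g = 0 then D * PY else D * PY * (3 * g)

/-- The denominator is positive (for `P_Y > 0`). [folklore] -/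
theorem gridM_pos {g D PY : ℕ} (hD : 0 < D) (hPY : 0 < PY) : 0 < gridM g D PY := by
  unfold gridM; split_ifs with hg
  · positivity
  · have : 0 < g := Nat.pos_of_ne_zero hg
    positivity

/-- **The grid point as one fraction**: for `P_Y > 0`,
`gridPt r (K/(D P_Y)) (3g) i = gridZ g a P_Y K i / gridM g D P_Y` with `a = num r`, `D = den r`,
`K = halfK g n v D`. [cite: AaronsonArkhipovToC2013, proof of Thm. 4.3, eq. (4.9) (p. 177)] -/
theorem gridPt_eq_div (g n : ℕ) {PY : ℕ} (hPY : 0 < PY) (r : ℚ) (v i : ℕ) :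
    gridPt r (((halfK g n v r.den : ℕ) : ℚ) / ((r.den : ℚ) * PY)) (3 * g) i =
      (gridZ g r.num PY (halfK g n v r.den) i : ℚ) / (gridM g r.den PY : ℚ) := by
  set K := halfK g n v r.den with hK
  have hD : (r.den : ℚ) ≠ 0 := by exact_mod_cast r.den_pos.ne'
  have hP : (PY : ℚ) ≠ 0 := by exact_mod_cast hPY.ne'
  have key : (r.num : ℚ) / r.den - (K : ℚ) / ((r.den : ℚ) * PY) + (i : ℚ) * (2 * ((K : ℚ) / ((r.den : ℚ) * PY)) / ((3 * g : ℕ) : ℚ)) =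
      (gridZ g r.num PY K i : ℚ) / (gridM g r.den PY : ℚ) := by
    by_cases hg : g = 0
    · subst hg
      simp only [gridZ, gridM, if_true, Nat.cast_zero, mul_zero, div_zero, add_zero]
      push_cast
      field_simp
    · have hL : ((3 * g : ℕ) : ℚ) ≠ 0 := by exact_mod_cast (show 3 * g ≠ 0 by omega)
      simp only [gridZ, gridM, hg, if_false]
      push_cast
      field_simp
  rw [Rat.num_div_den] at key
  rw [gridPt]
  exact key

/-- A numeral as a difference pair with empty negative part: `nzF u = ⟨u, ε⟩`, `ival (nzF u) = ⟦u⟧`. [folklore] -/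
def nzF : List Bool → List Bool := fanoutFn id fun _ => []

/-- Value of `nzF`. [folklore] -/
@[simp] theorem ival_nzF (u : List Bool) : ival (nzF u) = bitsToNat u := by simp [nzF, ival_boolPair]

/-- `nzF ∈ FP`. [cite: AroraBarak2009, §1.3] -/
theorem nzF_mem_FP : nzF ∈ FP := fanoutFn_mem_FP OracleCompose.id_mem_FP (const_mem_FP _)

/-- On `⟨A, ⟨P, ⟨K, i⟩⟩⟩` (`A` a difference pair; `P`, `K`, `i` numerals): **the grid numerator**
`dpEnc (gridZ G (ival A) ⟦P⟧ ⟦K⟧ ⟦i⟧)`. [cite: AaronsonArkhipovToC2013, proof of Thm. 4.3 (p. 177)] -/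
def gridZF (G : ℕ) : List Bool → List Bool :=
  if G = 0 then zsubF ∘ fanoutFn (zmulF ∘ fanoutFn (nthF 0) (nzF ∘ nthF 1)) (nzF ∘ nthF 2)
  else
    zaddF ∘ fanoutFn
      (zsubF ∘ fanoutFn
        (zmulF ∘ fanoutFn (zmulF ∘ fanoutFn (nthF 0) (nzF ∘ nthF 1)) fun _ => dpEnc (3 * G))
        (zmulF ∘ fanoutFn (nzF ∘ nthF 2) fun _ => dpEnc (3 * G)))
      (zmulF ∘ fanoutFn (zmulF ∘ fanoutFn (fun _ => dpEnc 2) (nzF ∘ nthF 2)) (nzF ∘ sndPow 2))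

/-- **Value of the grid numerator brick.** [folklore] -/
theorem gridZF_apply (G : ℕ) (A P K i : List Bool) :
    gridZF G (boolPair A (boolPair P (boolPair K i))) = dpEnc (gridZ G (ival A) (bitsToNat P) (bitsToNat K) (bitsToNat i)) := by
  unfold gridZF gridZ
  by_cases hG : G = 0
  · simp [hG, nthF]
  · simp [hG, nthF, sndPow]

/-- `gridZF G ∈ FP`. [cite: AroraBarak2009, §1.3] -/
theorem gridZF_mem_FP (G : ℕ) : gridZF G ∈ FP := by
  unfold gridZF
  split_ifs
  · exact comp_mem_FP zsubF_mem_FP (fanoutFn_mem_FP (comp_mem_FP zmulF_mem_FP (fanoutFn_mem_FP (nthF_mem_FP 0)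
      (comp_mem_FP nzF_mem_FP (nthF_mem_FP 1)))) (comp_mem_FP nzF_mem_FP (nthF_mem_FP 2)))
  · exact comp_mem_FP zaddF_mem_FP (fanoutFn_mem_FP
      (comp_mem_FP zsubF_mem_FP (fanoutFn_mem_FP
        (comp_mem_FP zmulF_mem_FP (fanoutFn_mem_FP (comp_mem_FP zmulF_mem_FP (fanoutFn_mem_FP (nthF_mem_FP 0)
          (comp_mem_FP nzF_mem_FP (nthF_mem_FP 1)))) (const_mem_FP _)))
        (comp_mem_FP zmulF_mem_FP (fanoutFn_mem_FP (comp_mem_FP nzF_mem_FP (nthF_mem_FP 2)) (const_mem_FP _)))))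
      (comp_mem_FP zmulF_mem_FP (fanoutFn_mem_FP (comp_mem_FP zmulF_mem_FP (fanoutFn_mem_FP (const_mem_FP _)
        (comp_mem_FP nzF_mem_FP (nthF_mem_FP 2)))) (comp_mem_FP nzF_mem_FP (sndPow_mem_FP 2)))))

/-- On `⟨D, P⟩`: **the grid denominator** `bin (gridM G ⟦D⟧ ⟦P⟧)`. [cite: AaronsonArkhipovToC2013, proof of Thm. 4.3 (p. 177)] -/
def gridMF (G : ℕ) : List Bool → List Bool :=
  if G = 0 then prodFn else prodFn ∘ fanoutFn prodFn fun _ => encodeNat (3 * G)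

/-- **Value of the grid denominator brick.** [folklore] -/
theorem gridMF_apply (G : ℕ) (D P : List Bool) : gridMF G (boolPair D P) = encodeNat (gridM G (bitsToNat D) (bitsToNat P)) := by
  unfold gridMF gridM
  by_cases hG : G = 0
  · simp [hG]
  · simp [hG]

/-- `gridMF G ∈ FP`. [cite: AroraBarak2009, §1.3] -/
theorem gridMF_mem_FP (G : ℕ) : gridMF G ∈ FP := by
  unfold gridMF
  split_ifs
  · exact prodFn_mem_FP
  · exact comp_mem_FP prodFn_mem_FP (fanoutFn_mem_FP prodFn_mem_FP (const_mem_FP _))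

/-! ### Coin blocks and the relabelled query -/

section Coins

variable (G : ℕ) (c q₀ : Polynomial ℕ)

/-- On `x`: the value `p(|x|)` of a polynomial in binary (`bin` of the unary `Plumb.polyFn`). [folklore] -/
def polyBinF (p : Polynomial ℕ) : List Bool → List Bool := lenBinF ∘ polyFn p

/-- Value of `polyBinF`. [folklore] -/
@[simp] theorem polyBinF_apply (p : Polynomial ℕ) (x : List Bool) : polyBinF p x = encodeNat (p.eval x.length) := by
  simp [polyBinF, ones]

/-- `polyBinF p ∈ FP`. [cite: AroraBarak2009, §1.3] -/
theorem polyBinF_mem_FP (p : Polynomial ℕ) : polyBinF p ∈ FP := comp_mem_FP lenBinF_mem_FP (polyFn_mem_FP p)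

/-- On `⟨x, ⟨i, ⟨s₁, ⟨s₂, ⟨s₃, s₄⟩⟩⟩⟩⟩` (numerals): **the block index** `bin (⟦i⟧ · NS + siteIdx s)` with
`NS = NSp(|x|)` and `siteIdx s = ((s₁ · 3 + s₂) · R + s₃)(3G + 1) + s₄`, `R = Rp(|x|)` (one block of fresh
coins per call site, Arora–Barak §7.4.1). [cite: AroraBarak2009, §7.4.1] -/
def blockIdxF : List Bool → List Bool :=
  addFn ∘ fanoutFn
    (prodFn ∘ fanoutFn (nthF 1) (polyBinF (NSp G q₀) ∘ nthF 0))
    (addFn ∘ fanoutFn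
      (prodFn ∘ fanoutFn
        (addFn ∘ fanoutFn
          (prodFn ∘ fanoutFn
            (addFn ∘ fanoutFn (prodFn ∘ fanoutFn (nthF 2) fun _ => encodeNat 3) (nthF 3))
            (polyBinF (Rp G q₀) ∘ nthF 0))
          (nthF 4))
        fun _ => encodeNat (3 * G + 1))
      (sndPow 4))

/-- **Value of the block index brick.** [folklore] -/
theorem blockIdxF_apply (x : List Bool) (i : ℕ) (s : Site) :
    blockIdxF G q₀ (boolPair x (boolPair (encodeNat i) (boolPair (encodeNat s.1) (boolPair (encodeNat s.2.1)
      (boolPair (encodeNat s.2.2.1) (encodeNat s.2.2.2)))))) =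
      encodeNat (i * (NSp G q₀).eval x.length + siteIdx G q₀ x.length s) := by
  obtain ⟨s₁, s₂, s₃, s₄⟩ := s
  simp [blockIdxF, siteIdx, nthF, sndPow]

/-- `blockIdxF G q₀ ∈ FP`. [cite: AroraBarak2009, §1.3] -/
theorem blockIdxF_mem_FP : blockIdxF G q₀ ∈ FP :=
  comp_mem_FP addFn_mem_FP (fanoutFn_mem_FP
    (comp_mem_FP prodFn_mem_FP (fanoutFn_mem_FP (nthF_mem_FP 1) (comp_mem_FP (polyBinF_mem_FP _) (nthF_mem_FP 0))))
    (comp_mem_FP addFn_mem_FP (fanoutFn_mem_FP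
      (comp_mem_FP prodFn_mem_FP (fanoutFn_mem_FP
        (comp_mem_FP addFn_mem_FP (fanoutFn_mem_FP
          (comp_mem_FP prodFn_mem_FP (fanoutFn_mem_FP
            (comp_mem_FP addFn_mem_FP (fanoutFn_mem_FP (comp_mem_FP prodFn_mem_FP (fanoutFn_mem_FP (nthF_mem_FP 2) (const_mem_FP _)))
              (nthF_mem_FP 3)))
            (comp_mem_FP (polyBinF_mem_FP _) (nthF_mem_FP 0))))
          (nthF_mem_FP 4)))
        (const_mem_FP _)))
      (sndPow_mem_FP 4))))

/-- On `⟨⟨x, r⟩, j⟩`: **the coin block** `chunk ℓ ⟦j⟧ r = (r ⇂ ⟦j⟧ ℓ) ↾ ℓ`, `ℓ = ellp(|x|)` (the drop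
count converted to unary with `r` as the ruler; dropping past the end empties the block either way). [cite: AroraBarak2009, §7.4.1] -/
def chunkF : List Bool → List Bool :=
  takeFn ∘ fanoutFn (polyFn (ellp G c q₀) ∘ fstF ∘ fstF)
    (dropFn ∘ fanoutFn
      (binToUnaryFn ∘ fanoutFn (sndF ∘ fstF) (prodFn ∘ fanoutFn sndF (polyBinF (ellp G c q₀) ∘ fstF ∘ fstF)))
      (sndF ∘ fstF))

/-- **Value of the coin block brick.** [folklore] -/
theorem chunkF_apply (x r : List Bool) (j : ℕ) :
    chunkF G c q₀ (boolPair (boolPair x r) (encodeNat j)) = chunk ((ellp G c q₀).eval x.length) j r := by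
  simp only [chunkF, Function.comp_apply, fanoutFn_apply, fstF_boolPair, sndF_boolPair, polyBinF_apply, prodFn_boolPair,
    bitsToNat_encodeNat, binToUnaryFn_boolPair, dropFn_boolPair, takeFn_boolPair, polyFn_apply, chunk]
  rw [show ∀ n : ℕ, (ones n).length = n from fun n => by simp [ones]]
  congr 1
  rw [show ∀ n : ℕ, (ones n).length = n from fun n => by simp [ones]]
  rcases le_total (j * (ellp G c q₀).eval x.length) r.length with h | h
  · rw [min_eq_left h]
  · rw [min_eq_right h, List.drop_length, List.drop_eq_nil_of_le h]

/-- `chunkF G c q₀ ∈ FP`. [cite: AroraBarak2009, §1.3] -/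
theorem chunkF_mem_FP : chunkF G c q₀ ∈ FP :=
  comp_mem_FP takeFn_mem_FP (fanoutFn_mem_FP (comp_mem_FP (polyFn_mem_FP _) (comp_mem_FP fstF_mem_FP fstF_mem_FP))
    (comp_mem_FP dropFn_mem_FP (fanoutFn_mem_FP
      (comp_mem_FP binToUnaryFn_mem_FP (fanoutFn_mem_FP (comp_mem_FP sndF_mem_FP fstF_mem_FP)
        (comp_mem_FP prodFn_mem_FP (fanoutFn_mem_FP sndF_mem_FP (comp_mem_FP (polyBinF_mem_FP _) (comp_mem_FP fstF_mem_FP fstF_mem_FP))))))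
      (comp_mem_FP sndF_mem_FP fstF_mem_FP))))

/-- `chunkF` on every input, through its fan-outs. [folklore] -/
theorem chunkF_eq (z : List Bool) :
    chunkF G c q₀ z = ((sndF (fstF z)).drop (binToUnaryFn (boolPair (sndF (fstF z))
      (prodFn (boolPair (sndF z) (polyBinF (ellp G c q₀) (fstF (fstF z))))))).length).take (polyFn (ellp G c q₀) (fstF (fstF z))).length := by
  simp only [chunkF, Function.comp_apply, fanoutFn_apply, dropFn_boolPair, takeFn_boolPair]

/-- The coin block is never longer than the coins: `|chunkF z| ≤ |sndF (fstF z)|` on every input. [folklore] -/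
theorem length_chunkF_le (z : List Bool) : (chunkF G c q₀ z).length ≤ (sndF (fstF z)).length := by
  rw [chunkF_eq, List.length_take, List.length_drop]
  omega

/-- On `⟨⟨x, r⟩, ⟨Q, j⟩⟩`: **the relabelled query** `⟨⟨Q, 1ᵏ⟩, chunk ℓ ⟦j⟧ r⟩`, `k = kp(|x|)` — the
shape `perSqQuery` of a query to the coin-taking `Per²`-oracle (matrix code, confidence in unary,
coins). [cite: AaronsonArkhipovToC2013, Def. 2.4 (p. 163) with Thm. 1.1 (p. 149)] -/
def querF : List Bool → List Bool :=
  fanoutFn (fanoutFn (fstF ∘ sndF) (polyFn (kp G q₀) ∘ fstF ∘ fstF)) (chunkF G c q₀ ∘ fanoutFn fstF (sndF ∘ sndF))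

/-- `querF G c q₀ ∈ FP`. [cite: AroraBarak2009, §1.3] -/
theorem querF_mem_FP : querF G c q₀ ∈ FP :=
  fanoutFn_mem_FP (fanoutFn_mem_FP (comp_mem_FP fstF_mem_FP sndF_mem_FP) (comp_mem_FP (polyFn_mem_FP _)
    (comp_mem_FP fstF_mem_FP fstF_mem_FP))) (comp_mem_FP (chunkF_mem_FP G c q₀) (fanoutFn_mem_FP fstF_mem_FP
    (comp_mem_FP sndF_mem_FP sndF_mem_FP)))

/-- **Value of the query brick**: `perSqQuery M k (chunk ℓ j r)`. [folklore] -/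
theorem querF_apply {n : ℕ} (M : Fin n → Fin n → ℤ) (x r : List Bool) (j : ℕ) :
    querF G c q₀ (boolPair (boolPair x r) (boolPair (encodingIntMatrix.encode ⟨n, M⟩) (encodeNat j))) =
      perSqQuery M ((kp G q₀).eval x.length) (chunk ((ellp G c q₀).eval x.length) j r) := by
  simp only [querF, fanoutFn_apply, Function.comp_apply, fstF_boolPair, sndF_boolPair, polyFn_apply, chunkF_apply, perSqQuery,
    OracleCompose.unaryEncodeNat_eq_replicate]

/-- **The query brick realises the coin map on canonical queries**: with the block index
`j = i · NS + siteIdx s` it returns `coinMap G c q₀ x r i (canon s M)`. [cite: AaronsonArkhipovToC2013, Thm. 1.1 (p. 149)] -/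
theorem querF_eq_coinMap (x r : List Bool) (i : ℕ) (s : Site) (M : Σ n : ℕ, Fin n → Fin n → ℤ) :
    querF G c q₀ (boolPair (boolPair x r) (boolPair (encodingIntMatrix.encode M)
      (encodeNat (i * (NSp G q₀).eval x.length + siteIdx G q₀ x.length s)))) = coinMap G c q₀ x r i (canon s M) := by
  obtain ⟨n, M⟩ := M
  rw [querF_apply, coinMap_canon]

end Coins

end PerSearch

end Literature.Computability.QuantumComplexity

end
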